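import Summits.FinalStateConjecture.FinalStateConjecture.Theorems.ClusterCompletenessAdiabaticMultiKerrILEDFarBoundary
import Summits.FinalStateConjecture.FinalStateConjecture.Theorems.ClusterCompletenessAdiabaticMultiKerrILEDFarDecay
import Summits.FinalStateConjecture.FinalStateConjecture.Theorems.ClusterCompletenessAdiabaticMultiKerrILEDFarGeometry

/-!
# Crux `AdiabaticMultiKerrILED` (line `Sketch`) — far-field transport: slab preliminaries

Helper file for the far-field Morawetz transport stub `stub_farTransport` of the line `Sketch`
(crux item `stmt-FinalStateConjecture-14310`, route `ClusterCompleteness`). Generic real analysis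
on the slab `ℝ × ℝ³` with `N` centres moving on straight lines `cᵢ(t) = pᵢ + t vᵢ` (`‖vᵢ‖ ≤ 1`):

* `fderiv_eq_zero_of_not_shell` : off the shells `{∃ i, ‖y − cᵢ(t)‖ ≤ 34Mᵢ} ∩ {∀ j, 17Mⱼ ≤ ‖y − cⱼ(t)‖}`
  the zone cut-off of `stub_zoneCutoff` is locally constant, so `dζ = 0` and `d²ζ = 0` there;
* `measurable_lintegral_slice`, `setLIntegral_slice_eq_lintegral_indicator` : slice integrals over
  `t`-dependent measurable sets;
* `decay_at_time` : the normalisation `(ψ(0,·) − c)/‖y‖ ∈ L²` far out propagates to `t ≥ 0` when the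
  exterior energy is bounded (registered sub-goal);
* `lintegral_abs_slice_le` : slab form of the fixed-time `L¹` bound
  `lintegral_abs_le_energy_of_farBound` (registered sub-goal).
-/

noncomputable section

set_option linter.dupNamespace false

open scoped ContDiff Topology ENNReal
open Filter Set MeasureTheory Literature.Geometry.Lorentzian

namespace Summit.FinalStateConjecture.FinalStateConjecture.Cruxes.AdiabaticMultiKerrILED.Sketch

/-! ### The zone cut-off is locally constant off the shells -/

/-- Off the shells `{∃ i, ‖dᵢ‖ ≤ 34Mᵢ} ∩ {∀ j, 17Mⱼ ≤ ‖dⱼ‖}` (`dᵢ = y − pᵢ − t vᵢ`) the zone cut-off is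
locally constant, so its first and second derivatives vanish there. [folklore] -/
theorem fderiv_eq_zero_of_not_shell {N : ℕ} {M : Fin N → ℝ} {p v : Fin N → E3} {ζ : E4 → ℝ}
    (hζ0 : ∀ x : E4, (∃ i, ‖E4.spatial x - p i - (x 0) • v i‖ < 17 * M i) → ζ =ᶠ[𝓝 x] fun _ ↦ 0)
    (hζ1 : ∀ x : E4, (∀ i, 34 * M i < ‖E4.spatial x - p i - (x 0) • v i‖) → ζ =ᶠ[𝓝 x] fun _ ↦ 1)
    {x : E4} (hx : ¬ ((∃ i, ‖E4.spatial x - p i - (x 0) • v i‖ ≤ 34 * M i) ∧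
      ∀ j, 17 * M j ≤ ‖E4.spatial x - p j - (x 0) • v j‖)) :
    fderiv ℝ ζ x = 0 ∧ fderiv ℝ (fderiv ℝ ζ) x = 0 := by
  obtain ⟨a, ha⟩ : ∃ a : ℝ, ζ =ᶠ[𝓝 x] fun _ ↦ a := by
    by_cases h17 : ∃ j, ‖E4.spatial x - p j - (x 0) • v j‖ < 17 * M j
    · exact ⟨0, hζ0 x h17⟩
    · push Not at h17
      have h34 : ∀ i, 34 * M i < ‖E4.spatial x - p i - (x 0) • v i‖ := by
        by_contra h
        push Not at h
        exact hx ⟨h, h17⟩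
      exact ⟨1, hζ1 x h34⟩
  have h1 : fderiv ℝ ζ =ᶠ[𝓝 x] fun _ ↦ (0 : E4 →L[ℝ] ℝ) := by
    filter_upwards [ha.eventuallyEq_nhds] with z hz
    rw [hz.fderiv_eq, fderiv_const_apply]
  refine ⟨h1.self_of_nhds, ?_⟩
  rw [h1.fderiv_eq, fderiv_const_apply]

/-! ### Measurability and continuity on the slab `ℝ × ℝ³` -/

/-- Measurability in `t` of a slice integral over a `t`-dependent measurable set. [folklore] -/
theorem measurable_lintegral_slice {S : Set (ℝ × E3)} (hS : MeasurableSet S) {g : ℝ × E3 → ℝ≥0∞}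
    (hg : Measurable g) : Measurable fun t : ℝ ↦ ∫⁻ y in {y : E3 | (t, y) ∈ S}, g (t, y) := by
  have h : (fun t : ℝ ↦ ∫⁻ y in {y : E3 | (t, y) ∈ S}, g (t, y)) =
      fun t ↦ ∫⁻ y, S.indicator g (t, y) := by
    funext t
    refine (lintegral_indicator (measurable_prodMk_left hS) (fun y ↦ g (t, y))).symm.trans ?_
    exact lintegral_congr fun y ↦ rfl
  rw [h]
  exact (hg.indicator hS).lintegral_prod_right'

/-- A slice integral over a `t`-dependent set is the integral of an indicator. [folklore] -/
theorem setLIntegral_slice_eq_lintegral_indicator {S : Set (ℝ × E3)} (hS : MeasurableSet S)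
    (g : ℝ × E3 → ℝ≥0∞) (t : ℝ) :
    ∫⁻ y in {y : E3 | (t, y) ∈ S}, g (t, y) = ∫⁻ y, S.indicator g (t, y) := by
  refine (lintegral_indicator (measurable_prodMk_left hS) (fun y ↦ g (t, y))).symm.trans ?_
  exact lintegral_congr fun y ↦ rfl

/-- The energy density `∑_μ (∂_μψ)²` is jointly continuous on the slab. [folklore] -/
theorem continuous_energyDensity_uncurry {ψ : E4 → ℝ} (hψ : ContDiff ℝ 1 ψ) :
    Continuous fun q : ℝ × E3 ↦
      ∑ κ : Fin 4, (fderiv ℝ ψ (E4.ofTimeSpace q.1 q.2) (E4.basisVector κ)) ^ 2 :=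
  continuous_finsetSum _ fun _ _ ↦
    (((hψ.continuous_fderiv one_ne_zero).comp E4.continuous_ofTimeSpace_uncurry).clm_apply
      continuous_const).pow 2

/-- Lab-frame bookkeeping on a slice: `‖spatial (t, y) − p − (t, y)⁰ v‖ = ‖y − p − t v‖`. [folklore] -/
theorem norm_spatial_ofTimeSpace_sub (t : ℝ) (y p v : E3) :
    ‖E4.spatial (E4.ofTimeSpace t y) - p - (E4.ofTimeSpace t y 0) • v‖ = ‖y - p - t • v‖ := by
  rw [E4.spatial_ofTimeSpace, E4.ofTimeSpace_apply_zero]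

/-! ### Decay at positive times -/

/-- **The normalisation propagates to positive times.** If `(ψ(0,·) − c)/‖y‖ ∈ L²` far out, the
exterior energy is bounded by `S < ∞` on `[0, t]`, and far out every slice point is exterior, then
`(ψ(t,·) − c)/‖y‖ ∈ L²` far out (`(ψ(t) − c)² ≤ 2(ψ(0) − c)² + 2(ψ(t) − ψ(0))²` and the decay lemma
`lintegral_sq_sub_div_norm_sq_le`). [folklore] -/
theorem decay_at_time {N : ℕ} {M : Fin N → ℝ} (hM : ∀ i, 0 < M i) {p v : Fin N → E3}
    (hv1 : ∀ i, ‖v i‖ ≤ 1) {Ext : Set (ℝ × E3)}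
    (hext : ∀ t : ℝ, 0 ≤ t → ∀ y : E3, (∀ j, 3 * M j < ‖y - p j - t • v j‖) → (t, y) ∈ Ext)
    {ψ : E4 → ℝ} (hψ : ContDiff ℝ 1 ψ) (c : ℝ)
    (hnorm : ∃ ρ : ℝ, ∫⁻ y in {y : E3 | ρ < ‖y‖},
      ENNReal.ofReal ((ψ (E4.ofTimeSpace 0 y) - c) ^ 2 / ‖y‖ ^ 2) < ⊤)
    {S : ℝ≥0∞} (hS : ∀ t : ℝ, 0 ≤ t → ∫⁻ y in {y : E3 | (t, y) ∈ Ext},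
      ENNReal.ofReal (∑ κ : Fin 4, (fderiv ℝ ψ (E4.ofTimeSpace t y) (E4.basisVector κ)) ^ 2) ≤ S)
    (hStop : S ≠ ⊤) {t : ℝ} (ht : 0 ≤ t) :
    ∃ ρ₀ : ℝ, ∫⁻ y in {y : E3 | ρ₀ < ‖y‖},
      ENNReal.ofReal ((ψ (E4.ofTimeSpace t y) - c) ^ 2 / ‖y‖ ^ 2) < ⊤ := by
  obtain ⟨ρ, hρ⟩ := hnorm
  have hsum0 : 0 ≤ ∑ j, (‖p j‖ + 3 * M j) :=
    Finset.sum_nonneg fun j _ ↦ by have := hM j; positivity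
  set ρ₀ : ℝ := max ρ 0 + 1 + t + ∑ j, (‖p j‖ + 3 * M j) with hρ₀
  have hmax0 := le_max_right ρ 0
  have hmaxρ := le_max_left ρ 0
  have hρ₀pos : 0 < ρ₀ := by rw [hρ₀]; linarith
  have hρρ₀ : ρ ≤ ρ₀ := by rw [hρ₀]; linarith
  have hbig : ∀ j, ‖p j‖ + t + 3 * M j < ρ₀ := by
    intro j
    have hj : ‖p j‖ + 3 * M j ≤ ∑ k, (‖p k‖ + 3 * M k) :=
      Finset.single_le_sum (f := fun k ↦ ‖p k‖ + 3 * M k)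
        (fun k _ ↦ by have := hM k; positivity) (Finset.mem_univ j)
    rw [hρ₀]; linarith
  refine ⟨ρ₀, ?_⟩
  -- pointwise splitting `(ψ(t) − c)² ≤ 2 (ψ(0) − c)² + 2 (ψ(t) − ψ(0))²`
  set A : E3 → ℝ≥0∞ := fun y ↦ ENNReal.ofReal ((ψ (E4.ofTimeSpace 0 y) - c) ^ 2 / ‖y‖ ^ 2) with hA
  set B : E3 → ℝ≥0∞ := fun y ↦
    ENNReal.ofReal ((ψ (E4.ofTimeSpace t y) - ψ (E4.ofTimeSpace 0 y)) ^ 2 / ‖y‖ ^ 2) with hB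
  have hpt : ∀ y : E3, ENNReal.ofReal ((ψ (E4.ofTimeSpace t y) - c) ^ 2 / ‖y‖ ^ 2) ≤
      2 * A y + 2 * B y := by
    intro y
    have hle : (ψ (E4.ofTimeSpace t y) - c) ^ 2 / ‖y‖ ^ 2 ≤
        2 * ((ψ (E4.ofTimeSpace 0 y) - c) ^ 2 / ‖y‖ ^ 2) +
          2 * ((ψ (E4.ofTimeSpace t y) - ψ (E4.ofTimeSpace 0 y)) ^ 2 / ‖y‖ ^ 2) := by
      rw [← mul_div_assoc, ← mul_div_assoc, ← add_div]
      refine div_le_div_of_nonneg_right ?_ (sq_nonneg _)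
      nlinarith [sq_nonneg (ψ (E4.ofTimeSpace t y) + c - 2 * ψ (E4.ofTimeSpace 0 y))]
    refine (ENNReal.ofReal_le_ofReal hle).trans_eq ?_
    rw [hA, hB, ENNReal.ofReal_add (by positivity) (by positivity), ENNReal.ofReal_mul zero_le_two,
      ENNReal.ofReal_mul zero_le_two, ENNReal.ofReal_ofNat]
  have hAm : Measurable A :=
    ENNReal.measurable_ofReal.comp
      ((((hψ.continuous.comp (E4.continuous_ofTimeSpace 0)).sub continuous_const).pow 2).measurable.div
        (continuous_norm.pow 2).measurable)
  -- the two pieces are finite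
  have hAfin : ∫⁻ y in {y : E3 | ρ₀ < ‖y‖}, A y < ⊤ :=
    lt_of_le_of_lt (lintegral_mono_set fun y (hy : ρ₀ < ‖y‖) ↦ show ρ < ‖y‖ by linarith) hρ
  have hBfin : ∫⁻ y in {y : E3 | ρ₀ < ‖y‖}, B y < ⊤ := by
    refine lt_of_le_of_lt (lintegral_sq_sub_div_norm_sq_le hψ ht hρ₀pos) ?_
    have hinner : ∀ s ∈ Ioo (0 : ℝ) t, ∫⁻ y in {y : E3 | ρ₀ < ‖y‖},
        ENNReal.ofReal ((fderiv ℝ ψ (E4.ofTimeSpace s y) (E4.basisVector 0)) ^ 2) ≤ S := by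
      intro s hs
      refine le_trans ?_ (hS s hs.1.le)
      refine (lintegral_mono fun y ↦ ENNReal.ofReal_le_ofReal ?_).trans (lintegral_mono_set ?_)
      · exact Finset.single_le_sum (f := fun κ : Fin 4 ↦
          (fderiv ℝ ψ (E4.ofTimeSpace s y) (E4.basisVector κ)) ^ 2) (fun κ _ ↦ sq_nonneg _)
          (Finset.mem_univ 0)
      · intro y hy
        exact hext s hs.1.le y fun j ↦ norm_d_gt_of_norm_gt (hv1 j) hs.1.le hs.2.le
          (lt_trans (hbig j) hy)
    have hI : ∫⁻ s in Ioo (0 : ℝ) t, ∫⁻ y in {y : E3 | ρ₀ < ‖y‖},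
        ENNReal.ofReal ((fderiv ℝ ψ (E4.ofTimeSpace s y) (E4.basisVector 0)) ^ 2) ≤
        S * volume (Ioo (0 : ℝ) t) := by
      rw [← setLIntegral_const]
      exact setLIntegral_mono' measurableSet_Ioo hinner
    refine ENNReal.mul_lt_top ENNReal.ofReal_lt_top (lt_of_le_of_lt hI ?_)
    exact ENNReal.mul_lt_top hStop.lt_top measure_Ioo_lt_top
  calc ∫⁻ y in {y : E3 | ρ₀ < ‖y‖}, ENNReal.ofReal ((ψ (E4.ofTimeSpace t y) - c) ^ 2 / ‖y‖ ^ 2)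
      ≤ ∫⁻ y in {y : E3 | ρ₀ < ‖y‖}, (2 * A y + 2 * B y) := lintegral_mono fun y ↦ hpt y
    _ = 2 * (∫⁻ y in {y : E3 | ρ₀ < ‖y‖}, A y) + 2 * (∫⁻ y in {y : E3 | ρ₀ < ‖y‖}, B y) := by
        rw [lintegral_add_left (hAm.const_mul _), lintegral_const_mul' _ _ ENNReal.ofNat_ne_top,
          lintegral_const_mul' _ _ ENNReal.ofNat_ne_top]
    _ < ⊤ := by
        refine ENNReal.add_lt_top.mpr ⟨?_, ?_⟩
        · exact ENNReal.mul_lt_top (by simp) hAfin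
        · exact ENNReal.mul_lt_top (by simp) hBfin

/-! ### The fixed-time `L¹` bound on a slice of the slab -/

/-- **Fixed-time `L¹` bound, slab form.** For a function `F` on `ℝ⁴` obeying the three-term bound of
`abs_farCurrent_le` on `{t ≥ 0}` (with the zone cut-off `ζ` and its `μ`-th partial derivative), the
slice `F(t, ·)`, `t ≥ 0`, has `∫ |F(t,·)| ≤ C_b · (exterior energy at time t)`. [folklore] -/
theorem lintegral_abs_slice_le {K : NNReal}
    (hPH : ∀ (n : ℕ) (c : Fin n → E3) (ρ : Fin n → ℝ), (∀ i, 0 < ρ i) →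
      (∀ i j, i ≠ j → 4 * (ρ i + ρ j) ≤ dist (c i) (c j)) →
      ∀ φ : E3 → ℝ, (∀ y : E3, (∀ i, ρ i < dist y (c i)) → ContDiffAt ℝ 1 φ y) →
      (∃ ρ₀ : ℝ, ∫⁻ y in {y : E3 | ρ₀ < ‖y‖}, ENNReal.ofReal (φ y ^ 2 / ‖y‖ ^ 2) < ⊤) →
      ∀ y₀ : E3, ∫⁻ y in {y : E3 | ∀ i, 2 * ρ i < dist y (c i)},
          ENNReal.ofReal (φ y ^ 2 / ‖y - y₀‖ ^ 2) ≤
        (K : ENNReal) * ∫⁻ y in {y : E3 | ∀ i, ρ i < dist y (c i)}, ENNReal.ofReal (‖fderiv ℝ φ y‖ ^ 2))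
    {N : ℕ} {M : Fin N → ℝ} (hM : ∀ i, 0 < M i) {p v : Fin N → E3}
    (hsep : ∀ t : ℝ, 0 ≤ t → ∀ i j, i ≠ j → 70 * (M i + M j) ≤ ‖(p i + t • v i) - (p j + t • v j)‖)
    {Ext : Set (ℝ × E3)} (hExtm : MeasurableSet Ext)
    (hext : ∀ t : ℝ, 0 ≤ t → ∀ y : E3, (∀ j, 3 * M j < ‖y - p j - t • v j‖) → (t, y) ∈ Ext)
    {ψ : E4 → ℝ} (hψ : ContDiff ℝ 1 ψ) (c : ℝ)
    {ζ : E4 → ℝ} (hζ01 : ∀ x, 0 ≤ ζ x ∧ ζ x ≤ 1)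
    (hζ0 : ∀ x : E4, (∃ i, ‖E4.spatial x - p i - (x 0) • v i‖ < 17 * M i) → ζ =ᶠ[𝓝 x] fun _ ↦ 0)
    (hζ1 : ∀ x : E4, (∀ i, 34 * M i < ‖E4.spatial x - p i - (x 0) • v i‖) → ζ =ᶠ[𝓝 x] fun _ ↦ 1)
    (hζsupp : ∀ x : E4, ζ x ≠ 0 → ∀ i, 17 * M i ≤ ‖E4.spatial x - p i - (x 0) • v i‖)
    {Kζ : ℝ} (hKζ : ∀ x : E4, 0 ≤ x 0 → ‖fderiv ℝ ζ x‖ ≤ Kζ)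
    {R : ℝ} (hR : 0 < R) {F : E4 → ℝ} {μ : Fin 4}
    (hF : ∀ x : E4, 0 ≤ x 0 → |F x| ≤ 5 * ζ x * (∑ κ, (fderiv ℝ ψ x (E4.basisVector κ)) ^ 2) +
      12 * ζ x * ((ψ x - c) ^ 2 / (E4.spatialNorm x + R) ^ 2) +
      |fderiv ℝ ζ x (E4.basisVector μ)| * ((ψ x - c) ^ 2 / (E4.spatialNorm x + R)))
    {t : ℝ} (ht : 0 ≤ t)
    (hdec : ∃ ρ₀ : ℝ, ∫⁻ y in {y : E3 | ρ₀ < ‖y‖},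
      ENNReal.ofReal ((ψ (E4.ofTimeSpace t y) - c) ^ 2 / ‖y‖ ^ 2) < ⊤) :
    ∫⁻ y, ENNReal.ofReal (|F (E4.ofTimeSpace t y)|) ≤
      ENNReal.ofReal (5 + 12 * K + Kζ / R * (1156 * K * ∑ i, M i ^ 2)) *
        ∫⁻ y in {y : E3 | (t, y) ∈ Ext},
          ENNReal.ofReal (∑ κ, (fderiv ℝ ψ (E4.ofTimeSpace t y) (E4.basisVector κ)) ^ 2) := by
  have hd : ∀ (y : E3) (i : Fin N),
      ‖E4.spatial (E4.ofTimeSpace t y) - p i - (E4.ofTimeSpace t y 0) • v i‖ = ‖y - (p i + t • v i)‖ := by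
    intro y i
    rw [norm_spatial_ofTimeSpace_sub, sub_add_eq_sub_sub]
  have hn1 : ‖E4.basisVector μ‖ = 1 := by simp [E4.basisVector]
  refine lintegral_abs_le_energy_of_farBound hPH hM (c := fun i ↦ p i + t • v i) ?_ ?_
    (measurable_prodMk_left hExtm) (w := fun y ↦ ψ (E4.ofTimeSpace t y) - c) ?_ hdec
    (P := fun y ↦ ∑ κ, (fderiv ℝ ψ (E4.ofTimeSpace t y) (E4.basisVector κ)) ^ 2)
    (ζ := fun y ↦ ζ (E4.ofTimeSpace t y))
    (ζ' := fun y ↦ fderiv ℝ ζ (E4.ofTimeSpace t y) (E4.basisVector μ))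
    (F := fun y ↦ F (E4.ofTimeSpace t y)) ?_ ?_ ?_ ?_ ?_ ?_ ?_ hR ?_
  · intro i j hij
    have := hsep t ht i j hij
    have := hM i
    have := hM j
    linarith
  · intro y hy
    refine hext t ht y fun j ↦ ?_
    have h8 := hy j
    rw [sub_add_eq_sub_sub] at h8
    have := hM j
    linarith
  · exact (hψ.comp (E4.contDiff_ofTimeSpace t)).sub contDiff_const
  · exact (continuous_finsetSum _ fun _ _ ↦ (((hψ.continuous_fderiv one_ne_zero).comp
      (E4.continuous_ofTimeSpace t)).clm_apply continuous_const).pow 2).measurable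
  · exact fun y ↦ Finset.sum_nonneg fun _ _ ↦ sq_nonneg _
  · intro y
    show ‖fderiv ℝ (fun y ↦ ψ (E4.ofTimeSpace t y) - c) y‖ ^ 2 ≤ _
    rw [fderiv_sub_const]
    exact norm_fderiv_slice_sq_le ((hψ.differentiable one_ne_zero) _)
  · exact fun y ↦ hζ01 _
  · intro y hy j
    rw [← hd y j]
    exact hζsupp _ hy j
  · intro y hy
    by_contra hcon
    apply hy
    have h0 := (fderiv_eq_zero_of_not_shell hζ0 hζ1 (x := E4.ofTimeSpace t y)
      (by simpa only [hd] using hcon)).1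
    show fderiv ℝ ζ (E4.ofTimeSpace t y) (E4.basisVector μ) = 0
    rw [h0]
    rfl
  · intro y
    have h := (fderiv ℝ ζ (E4.ofTimeSpace t y)).le_opNorm (E4.basisVector μ)
    rw [hn1, mul_one, Real.norm_eq_abs] at h
    exact h.trans (hKζ _ ht)
  · intro y
    have := hF (E4.ofTimeSpace t y) ht
    rwa [E4.spatialNorm_ofTimeSpace] at this

end Summit.FinalStateConjecture.FinalStateConjecture.Cruxes.AdiabaticMultiKerrILED.Sketch

end
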